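import Summits.HubbardSuperconductivity.HubbardSuperconductivity.Theses.ColourTheSpin
import Literature.MathematicalPhysics.QuantumLattice.SpinGaugedHubbardTorus
import HarnessLib

/-!
# Disproof of `SgEndpoint` — findings (cdisprove stmt-HubbardSuperconductivity-16272, route `ColourTheSpin`; cycle 1, 2026-08-17)

VERDICT OF THE CYCLE: **no kill is possible in principle** (insulation), and none of the crux's scalar
hypotheses can be DROPPED (each deletion collapses the item to the pointwise summit matrix). The substance
of the endpoint mechanism — (i) which flat `Q₈` class the `g → 0⁺` limit lands in, (ii) whether the limit
sees every Hubbard ground state — is testable only in UNCONDITIONAL finite-size form; those tests are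
recorded in §4 as typed statements with their numerical status (never as claimed theorems).

## Index
* §1 Verbatim cut `CorridorOrderAt` / `SectorLROAt`, `sgEndpoint_iff : … := Iff.rfl`.
* §2 INSULATION (sorry-free): `not_sgEndpoint_iff` — `¬SgEndpoint ↔ ∃` admissible `(U,δ,g₀,c',L₁)` with
  corridor order AND `¬` summit-matrix at `(U,δ)`; `not_not_sgEndpoint_of_not_sgCorridorOrder` (a disproof
  proves the route's rank-0 target; positively landed by a prover as `sgEndpoint_of_not_sgCorridorOrder`);
  `exists_not_sectorLROAt_of_not_sgEndpoint` (a disproof is a rigorous no-`d`-wave theorem for the pure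
  Hubbard model at a repulsive `U` and a doping in `(0,½)` — unavailable anywhere);
  `not_corridorOrderAt_of_not_sgCorridorOrder` (the lead's open stubs S2 `stub_trivialTwistSelection` and
  S4 `stub_someToEveryGroundState` carry the same antecedent, hence are equally insulated — they cannot be
  `stub-false`d, only reshaped).
* §3 LOAD-BEARING ANALYSIS (sorry-free; the `_false_without_` form is unavailable for EVERY hypothesis —
  see "why no `_false_without_`" below): `sgEndpoint_without_cpos_iff`, `sgEndpoint_without_gpos_iff`
  (deleting `0 < c'` or `0 < g₀` turns the crux into `∀ U>0 ∀ δ∈(0,½), SectorLROAt U δ`, i.e. summit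
  strength at EVERY point, via `corridorOrderAt_of_nonpos` = block positivity of `P†P`, resp. emptiness of
  the `g`-range); `sgEndpoint_iff_three_le` (WLOG `L₁ ≥ 3`: the doubled-bond `L = 2` member never matters);
  monotonicity `corridorOrderAt_mono` / `corridorOrderAt_anti_g₀`.
  WHY NO `_false_without_<H>`: every deleted variant still concludes the summit matrix somewhere or keeps
  the corridor antecedent; the antecedent is unverifiable wherever it might hold and FALSE wherever it is
  analysable (`δ ≥ 1`: `N_L = 0`, `P = 0` on the block; `δ = -1`: filled band, `‖P_kψ‖² = O(L²)`;
  `g ≫ L²`: electric freezing, sibling lane `Theorems/SgAnchorOrder/Negative/*`), so each variant is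
  vacuously TRUE there — the insulation is two-sided.
* §4 NATURAL STRENGTHENINGS / the line's stubs IN SUBSTANCE (typed, numerically tested, `sorry` = not
  formalised; evidence files attached to the item): `UnconditionalTwistFloorAt L U N` (S2 without its
  antecedent, pointwise in `L`) — FALSE at `(L,N) = (4,12)` for small `U > 0` (free-fermion shell effect,
  `E_(0,2) = -24.97 < -24 = E_(0,0)`, continuity in `U`) and false i.o. in even `L ≤ 400` at `U = 0` for
  every tested density (three independent computations: rattack `twist_free_U0.txt`, prover
  `S2-numerics-U0.txt`, this seat's job j025198 `free_twist_table.txt`); `d`-wave BdG caricature: all 22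
  classes split from the periodic one by `O(1/L)` of BOTH signs (job j025198 `bdg_twist_table.txt`) — so
  STRICT trivial selection (S2) fails i.o. even in the best case while the twist GAP → 0 (penalty_chord P2)
  survives; interacting `4×4` ED (`U = 2,4,8`, `N = 8,10,12`): see `ed_summary_*.txt` of j025198 / the N12 job
  (filled in at the next boundary). `GroundEigenspaceHomogeneousAt L U N` (S4's finite-size content):
  ED compression spectra of `Δ_d†Δ_d` on the sector ground eigenspace (same jobs).
* §5 WHY IT RESISTS (for the provers): the crux is `Corridor ⇒ Matrix` with an antecedent of summit
  strength on the route's own object; S1 (BO descent) and S3 (pure-gauge dictionary) are LANDED; what is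
  left (S2, S4) is exactly the two bits per `L` [twist] and [dark] of the strategist's census, both
  insulated by the antecedent and both FALSE in their unconditional finite-size forms at weak coupling.
  Recommended reshape (not this seat's call): S2 → twist-GAP form (P2 of `Lines/penalty_chord.lean`) or
  `stub_twistedToUntwisted`; S4 has no finite-volume tool (sibling census BirEveryGroundState).

Disproof.lean of this crux did not exist before this cycle; landed Negative lemma of an earlier refuter:
`Theorems/SgEndpoint/Negative/FlatSectorDecoupled.lean` (p150293: the electric term selects NOTHING among
flat classes — used in §4's reading of S2). This file's §1–§3 are proposed verbatim as
`Theorems/SgEndpoint/Negative/LoadBearing.lean` (proposal id in NOTES/HANDOFF).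
-/

noncomputable section

namespace Summit.HubbardSuperconductivity.HubbardSuperconductivity.Cruxes.SgEndpoint.Disproof

set_option linter.dupNamespace false -- summit = problem name (single-conjunct summit), D-0017
set_option linter.style.longLine false -- the route's `let`-text is kept VERBATIM (one line) so that `Iff.rfl` bridges to the item

/-! ## The crux cut into antecedent and consequent (route text VERBATIM) -/

section Verbatim

-- exactly the `open`s of the route file `Theses/ColourTheSpin.lean`, so that the text elaborates to the same term
open scoped BigOperators Topology Manifold Classical MeasureTheory ProbabilityTheory Matrix InnerProductSpace ComplexConjugate ContinuousMap
open Filter Set Function TopologicalSpace MeasureTheory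
open Literature.Hubbard

/-- **The corridor antecedent of `SgEndpoint` at `(U, δ, g₀, c', L₁)`** — the route's text verbatim: for
every `g ∈ (0, g₀]` and every even `L ≥ L₁`, every ground state `ψ` of the `N_L`-particle block of the
`Q₈`-spin-gauged torus `H_g(L,U)` has gauged `B₁g` pair order `c'·L⁴·‖ψ‖² ≤ ⟨ψ, P†P ψ⟩`
(`H = spinGaugedHubbardTorus L U g`, `P = spinGaugedPairField L` by `…_eq_inline`, `rfl`). [folklore] -/
def CorridorOrderAt (U δ g₀ c' : ℝ) (L₁ : ℕ) : Prop :=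
  open Literature.MathematicalPhysics.QuantumLattice in ∀ g : ℝ, 0 < g → g ≤ g₀ → ∀ (L : ℕ) [NeZero L], L₁ ≤ L → Even L → (let m : Fin 2 × ZMod 4 → Fin 2 × ZMod 4 → Fin 2 × ZMod 4 := fun u v => (u.1 + v.1, if u.1 = 0 then (if v.1 = 0 then u.2 + v.2 else v.2 - u.2) else if v.1 = 0 then u.2 + v.2 else 2 + v.2 - u.2); let iv : Fin 2 × ZMod 4 → Fin 2 × ZMod 4 := fun u => (u.1, if u.1 = 0 then -u.2 else u.2 + 2); let r : Fin 2 × ZMod 4 → Fin 2 → Fin 2 → ℂ := fun u σ τ => if u.1 = 0 then (if σ = τ then (if σ = 0 then Complex.I else -Complex.I) ^ u.2.val else 0) else if σ = τ then 0 else if σ = 0 then -(-Complex.I) ^ u.2.val else Complex.I ^ u.2.val; let hop := ∑ b : GaugedHubbard.Bond L, ∑ σ : Fin 2, ∑ τ : Fin 2, Matrix.kroneckerMap (· * ·) (creation (orb b.1 σ) * annihilation (orb (b.1.shift b.2) τ)) (Matrix.diagonal fun k : GaugedHubbard.Bond L → Fin 2 × ZMod 4 => r (k b) σ τ); let H :=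 -(hop + hopᴴ) + ((U : ℝ) : ℂ) • Matrix.kroneckerMap (· * ·) (∑ x : FermionTorus 2 L, numberOp x 0 * numberOp x 1) (1 : Matrix (GaugedHubbard.Bond L → Fin 2 × ZMod 4) (GaugedHubbard.Bond L → Fin 2 × ZMod 4) ℂ) + ((g ^ 2 : ℝ) : ℂ) • Matrix.kroneckerMap (· * ·) (1 : Matrix (Finset (Orb (FermionTorus 2 L))) _ ℂ) (∑ b : GaugedHubbard.Bond L, Matrix.of fun k k' : GaugedHubbard.Bond L → Fin 2 × ZMod 4 => if k' = Function.update k b (k' b) then (if k b = k' b then (1 : ℂ) else 0) - 1 / 8 else 0) + ((1 / g ^ 2 : ℝ) : ℂ) • Matrix.kroneckerMap (· * ·) (1 : Matrix (Finset (Orb (FermionTorus 2 L))) _ ℂ) (Matrix.diagonal fun k : GaugedHubbard.Bond L → Fin 2 × ZMod 4 => ∑ x : FermionTorus 2 L, (1 - (r (m (m (m (k (x, 0)) (k (x.shift 0, 1))) (iv (k (x.shift 1, 0)))) (iv (k (x, 1)))) 0 0 + r (m (m (m (k (x, 0)) (k (x.shift 0, 1))) (iv (k (x.shift 1, 0))))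 (iv (k (x, 1)))) 1 1) / 2)); let P := ∑ b : GaugedHubbard.Bond L, (if b.2 = 0 then (1 : ℂ) else -1) • ∑ σ : Fin 2, ∑ τ : Fin 2, Matrix.kroneckerMap (· * ·) (annihilation (orb b.1 σ) * annihilation (orb (b.1.shift b.2) τ)) (Matrix.diagonal fun k : GaugedHubbard.Bond L → Fin 2 × ZMod 4 => if σ = 0 then r (k b) 1 τ else -r (k b) 0 τ); let p := fun ik : Finset (Orb (FermionTorus 2 L)) × (GaugedHubbard.Bond L → Fin 2 × ZMod 4) => ik.1.card = 2 * ⌊(1 - δ) * (L : ℝ) ^ 2 / 2⌋₊; ∀ ψ : {ik // p ik} → ℂ, (ψ ≠ 0 ∧ ∃ E : ℝ, H.toBlock p p *ᵥ ψ = (E : ℂ) • ψ ∧ ∀ φ : {ik // p ik} → ℂ, E * (star φ ⬝ᵥ φ).re ≤ (star φ ⬝ᵥ H.toBlock p p *ᵥ φ).re) → c' * (L : ℝ) ^ 4 * (star ψ ⬝ᵥ ψ).re ≤ (star ψ ⬝ᵥ (Pᴴ * P).toBlock p p *ᵥ ψ).re)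

/-- **The consequent of `SgEndpoint` at `(U, δ)`** — the summit's matrix verbatim (the two leading
existentials of `Literature.Hubbard.DWaveSuperconductivityHubbard` stripped). [folklore] -/
def SectorLROAt (U δ : ℝ) : Prop :=
  open Literature.MathematicalPhysics.QuantumLattice in ∀ (N : ℕ → ℕ) (ψ : ∀ L, Fock (Orb (FermionTorus 2 L))), (∀ L, Even L → N L = 2 * ⌊(1 - δ) * (L : ℝ) ^ 2 / 2⌋₊ ∧ star (ψ L) ⬝ᵥ ψ L = 1 ∧ IsGroundStateInSector (hubbardTorus 2 L 1 U) (N L) 0 (ψ L)) → Literature.Probability.LatticeModels.HasLongRangeOrder (fun k => Literature.Probability.LatticeModels.halfOpenBox 2 (2 * k)) (fun k => torusPullback (pairFieldCorr dWaveFormFactor ψ) (2 * k))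

/-- The crux BY NAME is definitionally "antecedent → consequent, pointwise in `(U, δ)`". [folklore] -/
theorem sgEndpoint_iff :
    Summit.HubbardSuperconductivity.HubbardSuperconductivity.Theses.ColourTheSpin.SgEndpoint ↔
      ∀ (U δ g₀ c' : ℝ) (L₁ : ℕ), 0 < U → δ ∈ Set.Ioo (0 : ℝ) (1 / 2) → 0 < g₀ → 0 < c' →
        CorridorOrderAt U δ g₀ c' L₁ → SectorLROAt U δ :=
  Iff.rfl

/-- The route's rank-0 TARGET by name is definitionally "corridor order at SOME admissible parameters".
[folklore] -/
theorem sgCorridorOrder_iff :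
    Summit.HubbardSuperconductivity.HubbardSuperconductivity.Theses.ColourTheSpin.SgCorridorOrder ↔
      ∃ U : ℝ, 0 < U ∧ ∃ δ ∈ Set.Ioo (0 : ℝ) (1 / 2), ∃ g₀ : ℝ, 0 < g₀ ∧ ∃ c' : ℝ, 0 < c' ∧
        ∃ L₁ : ℕ, CorridorOrderAt U δ g₀ c' L₁ :=
  Iff.rfl

end Verbatim

open Matrix

/-! ## Insulation: the shape of any disproof -/

/-- **Insulation normal form.** `¬ SgEndpoint` is EQUIVALENT to the existence of admissible
`(U, δ, g₀, c', L₁)` at which the corridor antecedent HOLDS and the summit's matrix FAILS. [folklore] -/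
theorem not_sgEndpoint_iff :
    ¬ Summit.HubbardSuperconductivity.HubbardSuperconductivity.Theses.ColourTheSpin.SgEndpoint ↔
      ∃ (U δ g₀ c' : ℝ) (L₁ : ℕ), 0 < U ∧ δ ∈ Set.Ioo (0 : ℝ) (1 / 2) ∧ 0 < g₀ ∧ 0 < c' ∧
        CorridorOrderAt U δ g₀ c' L₁ ∧ ¬ SectorLROAt U δ := by
  rw [sgEndpoint_iff]
  push Not
  rfl

/-- **A disproof proves the route's target** (negative form): if corridor order holds NOWHERE (the
route's rank-0 target `SgCorridorOrder` fails), the crux cannot fail. Equivalently `¬ SgEndpoint →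
SgCorridorOrder` (landed positively as `sgEndpoint_of_not_sgCorridorOrder` in
`Theorems/ColourTheSpinSgEndpointStubBornOppenheimerFlatLimit.lean`): the witness parameters of any
refutation carry corridor order of the gauged torus. [folklore] -/
theorem not_not_sgEndpoint_of_not_sgCorridorOrder
    (h : ¬ Summit.HubbardSuperconductivity.HubbardSuperconductivity.Theses.ColourTheSpin.SgCorridorOrder) :
    ¬ ¬ Summit.HubbardSuperconductivity.HubbardSuperconductivity.Theses.ColourTheSpin.SgEndpoint := by
  intro hE
  obtain ⟨U, δ, g₀, c', L₁, hU, hδ, hg, hc, hC, -⟩ := not_sgEndpoint_iff.1 hE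
  exact h (sgCorridorOrder_iff.2 ⟨U, hU, δ, hδ, g₀, hg, c', hc, L₁, hC⟩)

/-- **A disproof refutes the summit's matrix at a point.** `¬ SgEndpoint` yields admissible `(U, δ)` at
which some normalised `(N_L, S^z = 0)`-sector ground-state sequence of `hubbardTorus 2 L 1 U` has NO
`d_{x²-y²}` pair-field long-range order — a rigorous no-go for the pure Hubbard model at a repulsive
coupling and a doping in `(0, ½)`, unavailable at any such point today. [folklore] -/
theorem exists_not_sectorLROAt_of_not_sgEndpoint
    (h : ¬ Summit.HubbardSuperconductivity.HubbardSuperconductivity.Theses.ColourTheSpin.SgEndpoint) :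
    ∃ (U δ : ℝ), 0 < U ∧ δ ∈ Set.Ioo (0 : ℝ) (1 / 2) ∧ ¬ SectorLROAt U δ := by
  obtain ⟨U, δ, g₀, c', L₁, hU, hδ, -, -, -, hS⟩ := not_sgEndpoint_iff.1 h
  exact ⟨U, δ, hU, hδ, hS⟩

/-- **Every corridor-conditional statement is insulated by the target.** If the route's target fails
(corridor order nowhere), then the corridor antecedent is FALSE at every admissible parameter, so ANY
statement of the shape "admissible parameters + corridor antecedent ⇒ `Q`" holds vacuously — the crux
(`Q :=` the summit matrix) and both open stubs of `Lines/birth.lean` (`stub_trivialTwistSelection`: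
`Q :=` eventual pure-gauge minimisers; `stub_someToEveryGroundState`: `Q :=` some ⇒ every ground-state
order) included: none of them can be refuted before the target is proved somewhere. [folklore] -/
theorem not_corridorOrderAt_of_not_sgCorridorOrder
    (h : ¬ Summit.HubbardSuperconductivity.HubbardSuperconductivity.Theses.ColourTheSpin.SgCorridorOrder)
    {U δ g₀ c' : ℝ} (L₁ : ℕ) (hU : 0 < U) (hδ : δ ∈ Set.Ioo (0 : ℝ) (1 / 2)) (hg : 0 < g₀)
    (hc : 0 < c') : ¬ CorridorOrderAt U δ g₀ c' L₁ :=
  fun hC => h (sgCorridorOrder_iff.2 ⟨U, hU, δ, hδ, g₀, hg, c', hc, L₁, hC⟩)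

/-! ## `0 < g₀` is load-bearing: without it the `g`-range may be empty -/

/-- With `g₀ ≤ 0` the corridor antecedent is VACUOUSLY true (no `g` with `0 < g ≤ g₀`). [folklore] -/
theorem corridorOrderAt_of_nonpos_g₀ {U δ g₀ c' : ℝ} {L₁ : ℕ} (hg : g₀ ≤ 0) :
    CorridorOrderAt U δ g₀ c' L₁ := by
  intro g hg0 hgg
  exact absurd (hg0.trans_le (hgg.trans hg)) (lt_irrefl 0)

/-- **`0 < g₀` deleted ⇒ the crux becomes the pointwise summit matrix** `∀ U > 0, ∀ δ ∈ (0,½),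
SectorLROAt U δ` (a statement implying the summit at once and asserting `d`-wave LRO of the pure
Hubbard model at EVERY repulsive coupling and doping). So the side condition `0 < g₀` is load-bearing:
it is what keeps the `g`-range of the antecedent non-empty. [folklore] -/
theorem sgEndpoint_without_gpos_iff :
    (∀ (U δ g₀ c' : ℝ) (L₁ : ℕ), 0 < U → δ ∈ Set.Ioo (0 : ℝ) (1 / 2) → 0 < c' →
        CorridorOrderAt U δ g₀ c' L₁ → SectorLROAt U δ) ↔
      ∀ (U δ : ℝ), 0 < U → δ ∈ Set.Ioo (0 : ℝ) (1 / 2) → SectorLROAt U δ := by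
  constructor
  · intro h U δ hU hδ
    exact h U δ 0 1 0 hU hδ one_pos (corridorOrderAt_of_nonpos_g₀ le_rfl)
  · intro h U δ _ _ _ hU hδ _ _
    exact h U δ hU hδ

/-! ## `0 < c'` is load-bearing: the block of `P†P` is a positive form -/

open scoped ComplexOrder in
/-- **Positivity of the compressed square.** For every matrix `M` and every predicate `p` on its index
type, the `p`-block of `Mᴴ * M` is a positive form: `0 ≤ Re ⟨ψ, (Mᴴ M)_{pp} ψ⟩` (a principal submatrix
of the positive semidefinite `Mᴴ M`). Stated for an ARBITRARY decidability instance of `p`, so that it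
applies to the route's inlined `let`-block verbatim. [folklore] -/
theorem re_star_dotProduct_toBlock_conjTranspose_mul_self_nonneg {n : Type*} [Fintype n]
    (M : Matrix n n ℂ) (p : n → Prop) [DecidablePred p] (ψ : {a // p a} → ℂ) :
    0 ≤ (star ψ ⬝ᵥ (Mᴴ * M).toBlock p p *ᵥ ψ).re := by
  have h1 : (Mᴴ * M).PosSemidef := Matrix.posSemidef_conjTranspose_mul_self M
  have h2 : ((Mᴴ * M).toBlock p p).PosSemidef := h1.submatrix _
  simpa using h2.re_dotProduct_nonneg ψ

open scoped ComplexOrder in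
/-- `0 ≤ Re ⟨ψ, ψ⟩`. [folklore] -/
theorem re_star_dotProduct_self_nonneg {ι : Type*} [Fintype ι] (ψ : ι → ℂ) :
    0 ≤ (star ψ ⬝ᵥ ψ).re :=
  (Complex.nonneg_iff.1 (dotProduct_star_self_nonneg ψ)).1

section NonPos

-- the route file's `open`s again: the antecedent is unfolded below and must elaborate identically
open scoped BigOperators Topology Manifold Classical MeasureTheory ProbabilityTheory Matrix InnerProductSpace ComplexConjugate ContinuousMap
open Filter Set Function TopologicalSpace MeasureTheory
open Literature.Hubbard Literature.MathematicalPhysics.QuantumLattice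

/-- **With `c' ≤ 0` the corridor antecedent holds TRIVIALLY**: its conclusion
`c'·L⁴·‖ψ‖² ≤ Re⟨ψ, (P†P)_{block} ψ⟩` has a non-positive left side and a non-negative right side, for
EVERY vector `ψ` (ground state or not), every `g`, every `L`. So the sign condition `0 < c'` is exactly
what makes the antecedent of `SgEndpoint` a genuine order hypothesis. [folklore] -/
theorem corridorOrderAt_of_nonpos {U δ g₀ c' : ℝ} {L₁ : ℕ} (hc : c' ≤ 0) :
    CorridorOrderAt U δ g₀ c' L₁ := by
  intro g _ _ L _ _ _ m iv r hop H P p ψ _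
  have hL : c' * (L : ℝ) ^ 4 * (star ψ ⬝ᵥ ψ).re ≤ 0 :=
    mul_nonpos_iff.2 (Or.inr ⟨mul_nonpos_iff.2 (Or.inr ⟨hc, by positivity⟩),
      re_star_dotProduct_self_nonneg ψ⟩)
  exact hL.trans (re_star_dotProduct_toBlock_conjTranspose_mul_self_nonneg P p ψ)

end NonPos

/-- **`0 < c'` deleted ⇒ the crux becomes the pointwise summit matrix** (`→`: instantiate the
deleted variant at `c' = 0`, where the antecedent is free by `corridorOrderAt_of_nonpos`; `←`: the
consequent does not depend on the antecedent). So `0 < c'` is load-bearing in the same sense as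
`0 < g₀`. [folklore] -/
theorem sgEndpoint_without_cpos_iff :
    (∀ (U δ g₀ c' : ℝ) (L₁ : ℕ), 0 < U → δ ∈ Set.Ioo (0 : ℝ) (1 / 2) → 0 < g₀ →
        CorridorOrderAt U δ g₀ c' L₁ → SectorLROAt U δ) ↔
      ∀ (U δ : ℝ), 0 < U → δ ∈ Set.Ioo (0 : ℝ) (1 / 2) → SectorLROAt U δ := by
  constructor
  · intro h U δ hU hδ
    exact h U δ 1 0 0 hU hδ one_pos (corridorOrderAt_of_nonpos le_rfl)
  · intro h U δ _ _ _ hU hδ _ _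
    exact h U δ hU hδ

/-! ## Monotonicity: the crux may assume `L₁ ≥ 3` -/

/-- The corridor antecedent is MONOTONE in the side threshold: order from `L₁` on gives order from any
`L₁' ≥ L₁` on. [folklore] -/
theorem corridorOrderAt_mono {U δ g₀ c' : ℝ} {L₁ L₁' : ℕ} (hL : L₁ ≤ L₁')
    (h : CorridorOrderAt U δ g₀ c' L₁) : CorridorOrderAt U δ g₀ c' L₁' :=
  fun g hg hgg L _ hL' hE => h g hg hgg L (hL.trans hL') hE

/-- The corridor antecedent is ANTITONE in `g₀`: order on `(0, g₀]` gives order on `(0, g₀']` for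
`g₀' ≤ g₀`. [folklore] -/
theorem corridorOrderAt_anti_g₀ {U δ g₀ g₀' c' : ℝ} {L₁ : ℕ} (hg : g₀' ≤ g₀)
    (h : CorridorOrderAt U δ g₀ c' L₁) : CorridorOrderAt U δ g₀' c' L₁ :=
  fun g hg0 hgg L _ hL hE => h g hg0 (hgg.trans hg) L hL hE

/-- **The crux is equivalent to its restriction to `L₁ ≥ 3`.** (`←`: given the antecedent from `L₁`,
it holds from `max L₁ 3` by monotonicity, and the restricted crux applies.) So the degenerate `L = 2`
member of the gauged family — doubled bonds, excluded from `SgHoppingDictionary` — is never needed, and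
every use of the antecedent may assume `3 ≤ L`, where the frozen trivial-link block IS
`hubbardTorus 2 L 1 U` (`spinGaugedHubbardTorus_apply_one_one`). [folklore] -/
theorem sgEndpoint_iff_three_le :
    Summit.HubbardSuperconductivity.HubbardSuperconductivity.Theses.ColourTheSpin.SgEndpoint ↔
      ∀ (U δ g₀ c' : ℝ) (L₁ : ℕ), 3 ≤ L₁ → 0 < U → δ ∈ Set.Ioo (0 : ℝ) (1 / 2) → 0 < g₀ → 0 < c' →
        CorridorOrderAt U δ g₀ c' L₁ → SectorLROAt U δ := by
  rw [sgEndpoint_iff]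
  constructor
  · intro h U δ g₀ c' L₁ _ hU hδ hg hc hC
    exact h U δ g₀ c' L₁ hU hδ hg hc hC
  · intro h U δ g₀ c' L₁ hU hδ hg hc hC
    exact h U δ g₀ c' (max L₁ 3) (le_max_right _ _) hU hδ hg hc
      (corridorOrderAt_mono (le_max_left _ _) hC)


/-! ## §4 Natural strengthenings — the line's stubs in substance (typed; numerical status in docstrings)

Vocabulary over LANDED Literature objects only (same terms as the landed twin stub
`Theorems.SgEndpoint.stub_bornOppenheimerFlatLimit_unfolded`): the frozen-link block at `k` is
`Matrix.of fun s s' => spinGaugedHubbardTorusWith Q8.rep L U 0 0 (s, k) (s', k)`. -/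

section Strengthenings

open Literature.MathematicalPhysics.QuantumLattice

/-- The `N`-block frozen ground energy `e₀(k)` at link configuration `k`. [folklore] -/
noncomputable def frozenGroundEnergy (L : ℕ) [NeZero L] (U : ℝ) (N : ℕ)
    (k : GaugedHubbard.Bond L → Q8) : ℝ :=
  (Matrix.of fun s s' => spinGaugedHubbardTorusWith Q8.rep L U 0 0 (s, k) (s', k)).minEnergyOn
    (nParticleSubmodule N : Submodule ℂ (Fock (Orb (FermionTorus 2 L))))

/-- `k` is flat (every plaquette holonomy trivial). [folklore] -/
def IsFlat (L : ℕ) [NeZero L] (k : GaugedHubbard.Bond L → Q8) : Prop :=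
  ∀ x : FermionTorus 2 L, SpinGauged.holonomy L k x = 1

/-- `k` is pure gauge (`k(x,i) = h_x h_{x+eᵢ}⁻¹`, the trivial class among the 22 flat ones). [folklore] -/
def IsPureGauge (L : ℕ) [NeZero L] (k : GaugedHubbard.Bond L → Q8) : Prop :=
  ∃ h : FermionTorus 2 L → Q8, ∀ b : GaugedHubbard.Bond L, k b = h b.1 * (h (b.1.shift b.2))⁻¹

/-- `k` is flat and minimises `e₀` among flat configurations. [folklore] -/
def IsFlatMinimiser (L : ℕ) [NeZero L] (U : ℝ) (N : ℕ) (k : GaugedHubbard.Bond L → Q8) : Prop :=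
  IsFlat L k ∧ ∀ k', IsFlat L k' → frozenGroundEnergy L U N k ≤ frozenGroundEnergy L U N k'

/-- **UNCONDITIONAL TWIST FLOOR at `(L, U, N)`** — stub S2 `stub_trivialTwistSelection` with its
corridor antecedent and its "eventually in `L`" stripped: every flat minimiser of the `N`-block frozen
energy is pure gauge (the zero-twist class is the floor among the 22 flat `Q₈` classes = abelian spin
twists `(m₁,m₂) ∈ ℤ₄²`, census §F5). NUMERICAL STATUS (evidence on the item): at `U = 0` FALSE for the
majority of even `L ≤ 400` at every tested density `δ ∈ {1/8, 1/5, 1/4, 3/10}` (`free_twist_table.txt`,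
job j025198; independently rattack `twist_free_U0.txt`, prover `S2-numerics-U0.txt`); at `(L,N)=(4,12)`:
`E_(0,2) = 2(2·(-2-√2) + 4·(-√2)) = -24.97 < -24 = E_(0,0)` at `U = 0`, hence FALSE for all small `U > 0`
by continuity of the finitely many block eigenvalues in `U` (`not_unconditionalTwistFloorAt_four_small`);
interacting values `U ∈ {2,4,8}`, `N ∈ {8,10,12}`: `ed_summary_*.txt` (jobs j025198 / N12). [folklore] -/
def UnconditionalTwistFloorAt (L : ℕ) [NeZero L] (U : ℝ) (N : ℕ) : Prop :=
  ∀ k : GaugedHubbard.Bond L → Q8, IsFlatMinimiser L U N k → IsPureGauge L k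

/-- NEAR-MISS (numerical, NOT formalised): the unconditional twist floor fails on the `4 × 4` torus with
`12` electrons (`δ ∈ (1/8, 1/4]`, inside the route's witness box) for all sufficiently small `U > 0`.
Mathematics: at `U = 0` the `(0,2)`-twisted block (antiperiodic in one direction for both spins = holonomy
`-1 = a²`) has `N`-block ground energy `-24.97… < -24 = ` periodic; block eigenvalues are continuous in
`U` at fixed `L`; a flat `k` with holonomy `(1, a²)` is not pure gauge. Obstruction to a Lean proof:
diagonalising the free `4×4` torus inside `Fock` (Slater determinants / Fourier modes over
`nParticleSubmodule`) is not in the tree; recorded as evidence only. [folklore] -/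
theorem not_unconditionalTwistFloorAt_four_small :
    ∃ U₀ : ℝ, 0 < U₀ ∧ ∀ U ∈ Set.Ioo (0 : ℝ) U₀, ¬ UnconditionalTwistFloorAt 4 U 12 := by
  sorry

/-- **GROUND-EIGENSPACE HOMOGENEITY at `(L, U, N)`** — the finite-size content of stub S4
`stub_someToEveryGroundState`: the compression of `Δ_d†Δ_d` to the `(N, S^z = 0)`-sector ground
eigenspace of `hubbardTorus 2 L 1 U` is a scalar. Where the sector ground state is unique this is
trivial; the `g → 0⁺` limit of the gauged family selects (census §F1) the extremisers of the kinetic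
energy `⟨T⟩` inside the frozen ground eigenspace, so S4 is needed exactly where this fails with `⟨T⟩`
non-constant. NUMERICAL STATUS: `4×4` ED compression spectra of `Δ_d†Δ_d`, `T`, `Σ n↑n↓` on the sector
ground eigenspace at `N ∈ {8,10,12}`, `U ∈ {2,4,8}` — `ed_summary_*.txt` of jobs j025198 / N12 (sibling
`Cruxes/BirEveryGroundState/Disproof.lean`: threefold sector ground eigenspace with split compression at
`(L,N) = (4,8)`). [folklore] -/
def GroundEigenspaceHomogeneousAt (L : ℕ) [NeZero L] (U : ℝ) (N : ℕ) : Prop :=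
  ∃ a : ℝ, ∀ ψ : Fock (Orb (FermionTorus 2 L)),
    IsGroundStateInSector (hubbardTorus 2 L 1 U) N 0 ψ →
      (expect ((pairField dWaveFormFactor L)ᴴ * pairField dWaveFormFactor L) ψ).re =
        a * (star ψ ⬝ᵥ ψ).re

end Strengthenings

end Summit.HubbardSuperconductivity.HubbardSuperconductivity.Cruxes.SgEndpoint.Disproof

end
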